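import Literature.AlgebraicGeometry.Motives.HodgeLieSymplecticBlocksRankFour
import Literature.AlgebraicGeometry.Motives.SymplecticRankFourIdeals
import Literature.AlgebraicGeometry.HodgeTheory.RealMultiplicationHodgeLieAlgebra
import Literature.AlgebraicGeometry.HodgeTheory.BettiOneHodgeStructureModelIndependence
import HarnessLib

/-!
# Real multiplication of relative dimension TWO, I: the four-dimensional blocks of `H¹(B) ⊗ ℂ` over the real places and
# `Lie Hg(H¹B) ⊗ ℂ ↠ 𝔰𝔭(V_τ)` at every place (Moonen–Zarhin 1995, Type I(2): `Hg = R_{F/ℚ} Sp_{4,F}`, per place)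

COR-CM (cell `pub-hodgecm2`, seat `b27` gen 46, count-neutral Mumford–Tate-rank ladder; theorems only, no definition, no named fact;
UNCONDITIONAL — nothing here uses or asserts HC_CM).  First CorCM file of the rung `t = 10e + 1` (type I(e) with `m = 2`): for a complex
abelian variety `B` whose endomorphism algebra is a TOTALLY REAL FIELD `E` of degree `e` with `dim B = 2e`, the joint eigenspaces
`V_τ ⊆ H¹(B, ℂ)` of `E` over the `e` real embeddings `τ : E → ℂ` are FOUR-dimensional (`dim_ℂ V_τ · [E:ℚ] = dim_ℚ H¹ = 2 dim B`), real,
pairwise `ψ_ℂ`-orthogonal, and the Literature theorem `SymplecticBlocks.exists_mem_hodgeLieC_restrict_eq`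
(`Motives/HodgeLieSymplecticBlocksRankFour`) applies: `Lie Hg(H¹B) ⊗ ℂ` restricts ONTO `𝔰𝔭(V_τ, ψ_ℂ|_{V_τ})` at every place `τ`.

* **`finrank_eigenBlock_hodgeCharacter_eq_four`** — `dim_ℂ V_τ = 4` when `dim B = 2 [End⁰B : ℚ]`.
* **`exists_mem_hodgeLieC_restrict_eq_of_relDimTwo`** — for every real place `τ` and every `ψ_ℂ|_{V_τ}`-skew `g : V_τ → V_τ` there is
  `Y ∈ Lie Hg(H¹B) ⊗ ℂ` with `Y|_{V_τ} = g` (every polarization `ψ` of `H¹B`).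

The Goursat assembly over the places (`Lie Hg ⊗ ℂ = ⊕_τ 𝔰𝔭(V_τ)`, `dim Lie Hg(H¹B) = 10e`, `t = 10e + 1`, Hodge = Lefschetz) is the sequel,
over the Literature files `Motives/HodgeLieSymplecticBlocksSemisimple`, `…Product`.

## References
* [MoonenZarhin1995Duke] B. Moonen, Yu. G. Zarhin, *Hodge classes and Tate classes on simple abelian fourfolds*, Duke Math. J. 77 (1995)
  (Type I(2): `Hg = R_{F/ℚ} Sp_F(V, ψ)`).
* [MoonenZarhin1999LowDim] B. Moonen, Yu. G. Zarhin, Math. Ann. 315 (1999), (2.2)–(2.3), §3 (3.1).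
* [Hazama1983] F. Hazama, Tôhoku Math. J. 35 (1983), §3 (the blocks `V_i` of `H¹(A, ℂ)`).
* [Deligne1982HodgeCycles] P. Deligne, LNM 900 (1982), §4 p. 30 (`H¹_B ⊗ ℂ = ⊕_σ H¹_{B,σ}`).
-/

noncomputable section

open scoped TensorProduct
open CategoryTheory Module NumberField

namespace Summit.HodgeConjecture.CorCM

open Literature.AlgebraicGeometry.Motives
open Literature.AlgebraicGeometry.Motives.AbelianVariety
open Literature.AlgebraicGeometry.Motives.HodgeStructure
open Literature.AlgebraicGeometry.HodgeTheory
open Literature.AlgebraicGeometry.ComplexMultiplication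

variable [HodgeTensorFacts.{0, 0}] {B : AbelianVariety ℂ} (hF : IsField B.endAlgebra)

/-! ## §1 The blocks `V_τ` are four-dimensional when `dim B = 2[E:ℚ]` -/

omit [HodgeTensorFacts.{0, 0}] in
/-- A number field has positive degree. [folklore] -/
private theorem finrank_pos_of_numberField'' (E : Type*) [Field E] [NumberField E] : 0 < Module.finrank ℚ E :=
  Module.finrank_pos

omit [HodgeTensorFacts.{0, 0}] in
include hF in
/-- `0 < [End⁰B : ℚ]` when `End⁰B` is a field (a number field has positive degree). [folklore] -/
private theorem finrank_endAlgebra_pos' : 0 < Module.finrank ℚ B.endAlgebra := by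
  rw [← EndField.finrank_eq hF]
  exact finrank_pos_of_numberField'' (EndField B hF)

omit [HodgeTensorFacts.{0, 0}] in
/-- **`dim_ℂ V_τ = 4`** for the joint eigenspace `V_τ ⊆ H¹(B, ℂ)` of `E = End⁰B` (a number field) at an embedding `τ : E → ℂ`, when
`dim B = 2[E:ℚ]`: `dim_ℂ V_τ · [E:ℚ] = dim_ℚ H¹ = 2 dim B = 4[E:ℚ]` (`EndAction.finrank_iInf_eigenspace_mul_finrank`).
[cite: Deligne1982HodgeCycles, §4 p. 30] [cite: Hazama1983, §3 (p. 305)] -/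
theorem finrank_eigenBlock_hodgeCharacter_eq_four (hHD : exists_isReal_hodgeModel) (hI : hodgePQ_independent_of_hodgeModel)
    (hdeg : B.dim = 2 * Module.finrank ℚ B.endAlgebra) (τ : EndField B hF →+* ℂ) :
    Module.finrank ℂ ((BettiUniverse.hodge hHD (AbelianVariety.isSmoothProjective_holds (A := B)) 1).eigenBlock
      (hodgeCharacter hF hHD hI τ)) = 4 := by
  haveI : FiniteDimensional ℚ (bettiCohomology B.X 1) := finite_bettiCohomology_one B
  rw [eigenBlock_hodgeCharacter]
  have h : Module.finrank ℂ ↥(⨅ e : EndField B hF, Module.End.eigenspace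
      ((hOneAlgHom (EndField.toEndAlgebra hF).toRingHom e).baseChange ℂ) (τ e)) *
      Module.finrank ℚ (EndField B hF) = Module.finrank ℚ (bettiCohomology B.X 1) :=
    (hOneEndAction (EndField.toEndAlgebra hF).toRingHom hHD hI (A := B)).finrank_iInf_eigenspace_mul_finrank τ
  rw [finrank_bettiCohomology_one, EndField.finrank_eq, hdeg] at h
  have hpos : 0 < Module.finrank ℚ B.endAlgebra := finrank_endAlgebra_pos' hF
  have h' : Module.finrank ℂ ↥(⨅ e : EndField B hF, Module.End.eigenspace
      ((hOneAlgHom (EndField.toEndAlgebra hF).toRingHom e).baseChange ℂ) (τ e)) * Module.finrank ℚ B.endAlgebra =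
      4 * Module.finrank ℚ B.endAlgebra := by rw [h]; ring
  exact Nat.eq_of_mul_eq_mul_right hpos h'

/-! ## §2 `Lie Hg(H¹B) ⊗ ℂ` restricts onto `𝔰𝔭(V_τ)` at every real place -/

/-- **Real multiplication of relative dimension two, per place: `Lie Hg(H¹B) ⊗ ℂ ↠ 𝔰𝔭(V_τ, ψ_ℂ|_{V_τ})`.**  For a complex abelian variety `B`
whose endomorphism algebra is a totally real field `E` with `dim B = 2[E:ℚ]`, every polarization `ψ` of `H¹(B, ℚ)`, every embedding
`τ : E → ℂ` and every `ℂ`-linear `g : V_τ → V_τ` skew for `ψ_ℂ|_{V_τ}`, some `Y ∈ Lie Hg(H¹B) ⊗ ℂ` restricts to `g` on `V_τ` — the Literature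
theorem `SymplecticBlocks.exists_mem_hodgeLieC_restrict_eq` fed with Riemann's `End_Hdg(H¹) = E` (self-adjoint, `isAdjointPair_self_of_isTotallyReal`),
the real characters `hodgeCharacter τ`, the internal direct sum `H¹ ⊗ ℂ = ⊕_τ V_τ` and §1.  (Moonen–Zarhin 1995, Type I(2), per place.)
[cite: MoonenZarhin1995Duke, Type I(2)] [cite: MoonenZarhin1999LowDim, §2 (2.2) and §3 (3.1)] [cite: Hazama1983, §3 (pp. 305–306)] -/
theorem exists_mem_hodgeLieC_restrict_eq_of_relDimTwo (hHD : exists_isReal_hodgeModel) (hI : hodgePQ_independent_of_hodgeModel)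
    [IsTotallyReal (EndField B hF)] (hdeg : B.dim = 2 * Module.finrank ℚ B.endAlgebra) [Module.Finite ℚ (bettiCohomology B.X 1)]
    (ψ : (BettiUniverse.hodge hHD (AbelianVariety.isSmoothProjective_holds (A := B)) 1).Polarization) (τ : EndField B hF →+* ℂ)
    (g : Module.End ℂ ↥((BettiUniverse.hodge hHD (AbelianVariety.isSmoothProjective_holds (A := B)) 1).eigenBlock (hodgeCharacter hF hHD hI τ)))
    (hg : ∀ x y : (BettiUniverse.hodge hHD (AbelianVariety.isSmoothProjective_holds (A := B)) 1).eigenBlock (hodgeCharacter hF hHD hI τ),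
      ψ.form.baseChange ℂ ((g x : (BettiUniverse.hodge hHD (AbelianVariety.isSmoothProjective_holds (A := B)) 1).eigenBlock
          (hodgeCharacter hF hHD hI τ)) : ℂ ⊗[ℚ] bettiCohomology B.X 1) y +
        ψ.form.baseChange ℂ (x : ℂ ⊗[ℚ] bettiCohomology B.X 1) ((g y : (BettiUniverse.hodge hHD
          (AbelianVariety.isSmoothProjective_holds (A := B)) 1).eigenBlock (hodgeCharacter hF hHD hI τ)) : ℂ ⊗[ℚ] bettiCohomology B.X 1) = 0) :
    ∃ Y ∈ (BettiUniverse.hodge hHD (AbelianVariety.isSmoothProjective_holds (A := B)) 1).hodgeLieC,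
      ∀ x : (BettiUniverse.hodge hHD (AbelianVariety.isSmoothProjective_holds (A := B)) 1).eigenBlock (hodgeCharacter hF hHD hI τ),
        ((g x : (BettiUniverse.hodge hHD (AbelianVariety.isSmoothProjective_holds (A := B)) 1).eigenBlock (hodgeCharacter hF hHD hI τ)) :
          ℂ ⊗[ℚ] bettiCohomology B.X 1) = Y x := by
  classical
  have hB0 : 0 < B.dim := by
    have hpos : 0 < Module.finrank ℚ B.endAlgebra := finrank_endAlgebra_pos' hF
    rw [hdeg]
    omega
  have hX : IsSmoothProjective B.dim B.X := AbelianVariety.isSmoothProjective_holds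
  exact SymplecticBlocks.exists_mem_hodgeLieC_restrict_eq _ Nat.cast_one (BettiUniverse.hodge_isEffective hHD hX 1) ψ
    (isAdjointPair_self_of_isTotallyReal hF hHD hI hB0 ψ) (hodgeCharacter hF hHD hI) (hodgeCharacter_isReal hF hHD hI)
    (isInternal_eigenBlock_hodgeCharacter hF hHD hI) (finrank_eigenBlock_hodgeCharacter_eq_four hF hHD hI hdeg) τ g hg

end Summit.HodgeConjecture.CorCM

end
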